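import Literature.NumberTheory.GaloisRepresentations.LubinTateHomExpansionTwo
import Literature.NumberTheory.GaloisRepresentations.LubinTateColemanCoordIwasawaActionTwo
import Literature.NumberTheory.GaloisRepresentations.PowerSeriesTopNilpotentBasisFree
import HarnessLib

/-!
# The Coleman coordinate module at `q = 2` is FREE OF RANK TWO over `𝒪_F⟦T⟧`, `T = σ_γ − 1` (`γ = 1 + π²w` a topological generator
# of `1 + 4ℤ₂`), with basis `{1, Y}`: `𝒪_F⟦Y⟧ = 𝒪_F⟦T⟧·1 ⊕ 𝒪_F⟦T⟧·Y ≅ Λ(ℤ₂^×)` (de Shalit I §3.1, Theorem I.3.7 — Lubin–Tate direction)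

De Shalit, *Iwasawa theory of elliptic curves with complex multiplication* (1987), Ch. I §3.1 ("when `p = 2` … `Γ = 1 + 4ℤ₂`,
`Λ = ℤ₂⟦Γ'⟧ ≅ ℤ₂⟦S⟧`, `ℤ₂⟦𝒢⟧ = Λ[Δ]`") and Theorem I.3.7 (the norm-coherent units are, through Coleman's map, a `Λ(𝒢)`-module
commensurable with `Λ(𝒢)`).  In the tree's series currency at `q = 2` (`F` with `|𝓀_F| = 2`, `π = 2u`, `f = πX + X²`): the
coordinates `r_β ∈ 𝒪_F⟦Y⟧` of `LubinTateColemanTraceKernelTwo` carry the `𝒪_F⟦T⟧`-module structure `c(T)·r = Σ c_k D_γ^k r`,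
`D_γ = σ_γ − 1 : r ↦ γ·ρ_γ·(r ∘ [γ]_f) − r` (`LubinTateColemanCoordIwasawaActionTwo`, `r_{σ_{γ^n}β} = (1+T)^n·r_β`).  This file proves:

* ★★ `twistLinear_X_pow_sub_mem_degFilt` — **`D_γ(Y^k) ≡ Y^{k+2} (mod π, Y^{k+3})`** for every `k`, when `γ = 1 + π²w` with `w` a unit
  (from `[γ]_f ≡ X + X⁴(1 + XG)` and `ρ_γ ≡ 1 + Y² + Y³R (mod π)`, `LubinTateHomExpansionTwo`:
  `ρ̄_γ·[γ]̄^k − Y^k − Y^{k+2} = Y^{k+3}·(…)` in `𝓀_F⟦Y⟧`);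
* ★★★ `existsUnique_tAct_twistLinear_two` — **every `r ∈ 𝒪_F⟦Y⟧` is UNIQUELY `a(T)·1 + b(T)·Y`** with `a, b ∈ 𝒪_F⟦T⟧`: the coordinate
  module is free of rank two over `Λ(Γ') = 𝒪_F⟦T⟧`, `Γ' = γ^{ℤ₂}` of index `2 = |Δ|` in `𝒪_F^× ≅ Gal(K_π^∞/F)` — i.e.
  `𝒪_F⟦Y⟧ ≅ Λ(Γ')² ≅ Λ(ℤ₂^×)` as `Λ(Γ')`-modules (`PowerSeriesTopNilpotentBasisFree.existsUnique_tAct_one_add_tAct_X`);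
* ★ `unitCoordTwo_unitAct_pow_eq_pair` — on the norm-coherent units: if `r_β = a·1 + b·Y` then
  `r_{σ_{γ^n}β} = ((1+T)^n a)·1 + ((1+T)^n b)·Y` (the coordinate isomorphism is `Λ(Γ')`-linear on `𝒰`).

Everything PROVED (0 sorry, no named facts, no new definitions).  With `LubinTateColemanTwoVariableCokernelTwo` (the principal units
embed with cyclic cokernel) this is «`U ≅ Λ ⊕ (finite)`» in the Lubin–Tate direction at `p = 2`, series side.

## References

* E. de Shalit, *Iwasawa theory of elliptic curves with complex multiplication* (1987), Ch. I §3.1, §3.4 Lemma (ii), §3.7. [deShalit1987]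
* L. C. Washington, *Introduction to Cyclotomic Fields*, 2nd ed. (1997), §13.2. [Washington1997]
-/

noncomputable section

open scoped PowerSeries.WithPiTopology

namespace Literature.NumberTheory.GaloisRepresentations

section CoordFreeTwo

open GaloisRepresentations.IsNonarchimedeanLocalField LubinTate ValuativeRel Finset

variable {F : Type} [Field F] [ValuativeRel F] [TopologicalSpace F] [IsNonarchimedeanLocalField F]

attribute [local instance] ltNormUniformSpace ltNormIsUniformAddGroup rk1 nF nE fintypeResidueField

variable {π : 𝒪[F]} (hπ : (valuation F).IsUniformizer (π : F)) (hq : residueFieldCard F = 2)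

/-! ### `D_γ(Y^k) ≡ Y^{k+2} (mod π, Y^{k+3})` -/

/-- ★★ **`D_γ(Y^k) − Y^{k+2} ∈ (π) + (Y^{k+3})`** for `D_γ r = γ·ρ_γ·(r ∘ [γ]_f) − r`, `γ = 1 + π²w`, `w` a unit (`q = 2`, `π = 2u`):
modulo `π`, `ρ̄_γ·[γ]̄^k − Y^k = (1 + Y² + Y³R)(Y + Y⁴(1 + YG))^k − Y^k = Y^{k+2} + Y^{k+3}(…)`. [cite: deShalit1987, Ch. I §3.1, §3.4 Lemma (ii)] -/
theorem twistLinear_X_pow_sub_mem_degFilt (u : (LTCoeff F)ˣ) (hu : LTCoeff.of F π = residueFieldCard F * u) (γ w : 𝒪[F]ˣ)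
    (hγ : (γ : 𝒪[F]) = 1 + π ^ 2 * w) (k : ℕ) :
    twistLinear hπ hq u γ (PowerSeries.X ^ k) - PowerSeries.X ^ (k + 2) ∈ degFilt (LTCoeff.of F π) (k + 2 + 1) := by
  have ht := two_eq_of_mul_inv hq u hu
  obtain ⟨G, hG⟩ := redSeries_hom_two hπ hq ht γ w hγ
  obtain ⟨c0, c1, c2⟩ := coeff_redSeries_rho_two hπ hq u hu γ w hγ
  set H := hom (isLTRing_LTCoeff hπ) (isLTSeries_LTCoeff π) (isLTSeries_LTCoeff π) (LTCoeff.of F (γ : 𝒪[F])) with hH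
  set ρ := evenPartTwo hπ hq (unitTwistSerTwo hπ (↑u⁻¹ : LTCoeff F) γ) with hρ
  have hs : PowerSeries.HasSubst H := PowerSeries.HasSubst.of_constantCoeff_zero' (by rw [hH]; exact constantCoeff_hom _ _ _ _)
  -- `ρ̄ = 1 + Y² + Y³ R`
  have hRd : (PowerSeries.X : PowerSeries 𝓀[F]) ^ 3 ∣ redSeries F ρ - 1 - PowerSeries.X ^ 2 := by
    rw [PowerSeries.X_pow_dvd_iff]
    intro m hm
    rw [map_sub, map_sub, PowerSeries.coeff_one, PowerSeries.coeff_X_pow]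
    interval_cases m
    · rw [c0]; simp
    · rw [c1]; simp
    · rw [c2]; simp
  obtain ⟨R, hR⟩ := hRd
  have hR' : redSeries F ρ = 1 + PowerSeries.X ^ 2 + PowerSeries.X ^ 3 * R := by linear_combination hR
  -- `(1 + Y³(1 + YG))^k = 1 + Y³ G₂`
  obtain ⟨G₂, hG₂⟩ : ∃ G₂ : PowerSeries 𝓀[F], (1 + PowerSeries.X ^ 3 * (1 + PowerSeries.X * G)) ^ k = 1 + PowerSeries.X ^ 3 * G₂ := by
    obtain ⟨Q, hQ⟩ := sub_dvd_pow_sub_pow (1 + PowerSeries.X ^ 3 * (1 + PowerSeries.X * G) : PowerSeries 𝓀[F]) 1 k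
    refine ⟨(1 + PowerSeries.X * G) * Q, ?_⟩
    rw [one_pow, add_sub_cancel_left] at hQ
    linear_combination hQ
  -- the reduction of `D(Y^k) − Y^{k+2}`
  have hDk : twistLinear hπ hq u γ (PowerSeries.X ^ k) = PowerSeries.C (LTCoeff.of F (γ : 𝒪[F])) * ρ * H ^ k - PowerSeries.X ^ k := by
    rw [twistLinear_apply, ← hH, ← hρ, PowerSeries.subst_pow hs, PowerSeries.subst_X hs]
  have hred : redSeries F (twistLinear hπ hq u γ (PowerSeries.X ^ k) - PowerSeries.X ^ (k + 2)) =
      PowerSeries.X ^ (k + 3) * (G₂ + PowerSeries.X ^ 2 * G₂ + R * (1 + PowerSeries.X ^ 3 * G₂)) := by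
    rw [hDk, map_sub, map_sub, map_mul, map_mul, map_pow, map_pow, map_pow, redSeries_C, residue_of_unit_two hπ hq γ, map_one, one_mul,
      hG, redSeries_X, hR', show (PowerSeries.X + PowerSeries.X ^ 4 * (1 + PowerSeries.X * G) : PowerSeries 𝓀[F]) =
        PowerSeries.X * (1 + PowerSeries.X ^ 3 * (1 + PowerSeries.X * G)) by ring, mul_pow, hG₂]
    ring
  -- conclude coefficientwise
  intro i hi
  have hc := congrArg (PowerSeries.coeff i) hred
  rw [coeff_redSeries, PowerSeries.coeff_X_pow_mul', if_neg (by omega)] at hc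
  exact (residue_eq_zero_iff_mem hπ _).mp hc

/-! ### Freeness of rank two -/

/-- ★★★ **The Coleman coordinate module `𝒪_F⟦Y⟧` is free of rank two over `𝒪_F⟦T⟧`, `T = σ_γ − 1`, with basis `{1, Y}`**: for
`γ = 1 + π²w` (`w` a unit — a topological generator of `1 + 4ℤ₂ ≅ Γ'`, `F` with `|𝓀_F| = 2` and `π = 2u`), every `r ∈ 𝒪_F⟦Y⟧` is
UNIQUELY `a(T)·1 + b(T)·Y` for the action `c(T)·r = Σ_k c_k D_γ^k r` — `𝒪_F⟦Y⟧ ≅ Λ(Γ')·1 ⊕ Λ(Γ')·Y ≅ Λ(ℤ₂^×)` (`[ℤ₂^× : Γ'] = |Δ| = 2`),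
the Lubin–Tate direction of the `Λ`-structure in Theorem I.3.7 at `p = 2`. [cite: deShalit1987, Ch. I §3.1, §3.7] -/
theorem existsUnique_tAct_twistLinear_two (u : (LTCoeff F)ˣ) (hu : LTCoeff.of F π = residueFieldCard F * u) (γ w : 𝒪[F]ˣ)
    (hγ : (γ : 𝒪[F]) = 1 + π ^ 2 * w) (r : PowerSeries (LTCoeff F)) :
    haveI := isAdicComplete_LTCoeff hπ
    ∃! ab : PowerSeries (LTCoeff F) × PowerSeries (LTCoeff F),
      tAct (twistLinear hπ hq u γ) (twistLinear_mem_adicFiltGen_succ hπ hq u hu γ) ab.1 1 +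
        tAct (twistLinear hπ hq u γ) (twistLinear_mem_adicFiltGen_succ hπ hq u hu γ) ab.2 PowerSeries.X = r := by
  haveI := isAdicComplete_LTCoeff hπ
  exact existsUnique_tAct_one_add_tAct_X (twistLinear_mem_adicFiltGen_succ hπ hq u hu γ) (isLTRing_LTCoeff hπ).eq_zero_of_mul_eq_zero
    (twistLinear_X_pow_sub_mem_degFilt hπ hq u hu γ w hγ) r

/-- ★★★ The same in existence / uniqueness form: **`∃ a b, a·1 + b·Y = r`, and `a·1 + b·Y = a′·1 + b′·Y ⟹ a = a′ ∧ b = b′`**.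
[cite: deShalit1987, Ch. I §3.1, §3.7] -/
theorem exists_tAct_twistLinear_two_and_unique (u : (LTCoeff F)ˣ) (hu : LTCoeff.of F π = residueFieldCard F * u) (γ w : 𝒪[F]ˣ)
    (hγ : (γ : 𝒪[F]) = 1 + π ^ 2 * w) :
    haveI := isAdicComplete_LTCoeff hπ
    (∀ r : PowerSeries (LTCoeff F), ∃ a b : PowerSeries (LTCoeff F),
      tAct (twistLinear hπ hq u γ) (twistLinear_mem_adicFiltGen_succ hπ hq u hu γ) a 1 +
        tAct (twistLinear hπ hq u γ) (twistLinear_mem_adicFiltGen_succ hπ hq u hu γ) b PowerSeries.X = r) ∧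
    ∀ a b a' b' : PowerSeries (LTCoeff F),
      tAct (twistLinear hπ hq u γ) (twistLinear_mem_adicFiltGen_succ hπ hq u hu γ) a 1 +
          tAct (twistLinear hπ hq u γ) (twistLinear_mem_adicFiltGen_succ hπ hq u hu γ) b PowerSeries.X =
        tAct (twistLinear hπ hq u γ) (twistLinear_mem_adicFiltGen_succ hπ hq u hu γ) a' 1 +
          tAct (twistLinear hπ hq u γ) (twistLinear_mem_adicFiltGen_succ hπ hq u hu γ) b' PowerSeries.X → a = a' ∧ b = b' := by
  haveI := isAdicComplete_LTCoeff hπ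
  refine ⟨fun r => ?_, fun a b a' b' h => ?_⟩
  · obtain ⟨ab, hab, -⟩ := existsUnique_tAct_twistLinear_two hπ hq u hu γ w hγ r
    exact ⟨ab.1, ab.2, hab⟩
  · obtain ⟨ab, -, huniq⟩ := existsUnique_tAct_twistLinear_two hπ hq u hu γ w hγ
      (tAct (twistLinear hπ hq u γ) (twistLinear_mem_adicFiltGen_succ hπ hq u hu γ) a' 1 +
        tAct (twistLinear hπ hq u γ) (twistLinear_mem_adicFiltGen_succ hπ hq u hu γ) b' PowerSeries.X)
    have h1 := huniq (a, b) h
    have h2 := huniq (a', b') rfl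
    have e := h1.trans h2.symm
    exact ⟨congrArg Prod.fst e, congrArg Prod.snd e⟩

/-! ### On the norm-coherent units: the coordinates `(a_β, b_β)` are `Λ(Γ')`-equivariant -/

/-- ★ **`r_β = a·1 + b·Y ⟹ r_{σ_{γ^n}β} = ((1+T)^n a)·1 + ((1+T)^n b)·Y`**: the isomorphism `𝒪_F⟦Y⟧ ≅ 𝒪_F⟦T⟧²` intertwines the
action of `γ^ℕ ⊆ Γ' ⊆ Gal(K_π^∞/F)` on the norm-coherent units with multiplication by `(1+T)^n` on `Λ(Γ')²` (de Shalit's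
`u^α ↦ (1+S)^α`). [cite: deShalit1987, Ch. I §3.1, §3.4 Lemma (ii)] -/
theorem unitCoordTwo_unitAct_pow_eq_pair (u : (LTCoeff F)ˣ) (hu : LTCoeff.of F π = residueFieldCard F * u) (γ : 𝒪[F]ˣ)
    (β : NormCoherentUnits hπ) {a b : PowerSeries (LTCoeff F)}
    (hab : haveI := isAdicComplete_LTCoeff hπ
      tAct (twistLinear hπ hq u γ) (twistLinear_mem_adicFiltGen_succ hπ hq u hu γ) a 1 +
        tAct (twistLinear hπ hq u γ) (twistLinear_mem_adicFiltGen_succ hπ hq u hu γ) b PowerSeries.X = unitCoordTwo hπ hq u β) (n : ℕ) :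
    haveI := isAdicComplete_LTCoeff hπ
    tAct (twistLinear hπ hq u γ) (twistLinear_mem_adicFiltGen_succ hπ hq u hu γ) ((1 + PowerSeries.X) ^ n * a) 1 +
        tAct (twistLinear hπ hq u γ) (twistLinear_mem_adicFiltGen_succ hπ hq u hu γ) ((1 + PowerSeries.X) ^ n * b) PowerSeries.X =
      unitCoordTwo hπ hq u (β.unitAct (γ ^ n)) := by
  haveI := isAdicComplete_LTCoeff hπ
  rw [unitCoordTwo_unitAct_pow_eq_tAct hπ hq u hu γ β n, ← hab, tAct_add_right, tAct_mul, tAct_mul]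

/-- ★ **Uniqueness of the equivariant coordinates**: if `r_β = a·1 + b·Y` and `r_{σ_{γ^n}β} = a′·1 + b′·Y` then `a′ = (1+T)^n a` and
`b′ = (1+T)^n b` (`γ = 1 + π²w`, `w` a unit). [cite: deShalit1987, Ch. I §3.1, §3.4 Lemma (ii), §3.7] -/
theorem pair_unitAct_pow_eq (u : (LTCoeff F)ˣ) (hu : LTCoeff.of F π = residueFieldCard F * u) (γ w : 𝒪[F]ˣ)
    (hγ : (γ : 𝒪[F]) = 1 + π ^ 2 * w) (β : NormCoherentUnits hπ) {a b a' b' : PowerSeries (LTCoeff F)}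
    (hab : haveI := isAdicComplete_LTCoeff hπ
      tAct (twistLinear hπ hq u γ) (twistLinear_mem_adicFiltGen_succ hπ hq u hu γ) a 1 +
        tAct (twistLinear hπ hq u γ) (twistLinear_mem_adicFiltGen_succ hπ hq u hu γ) b PowerSeries.X = unitCoordTwo hπ hq u β) (n : ℕ)
    (hab' : haveI := isAdicComplete_LTCoeff hπ
      tAct (twistLinear hπ hq u γ) (twistLinear_mem_adicFiltGen_succ hπ hq u hu γ) a' 1 +
        tAct (twistLinear hπ hq u γ) (twistLinear_mem_adicFiltGen_succ hπ hq u hu γ) b' PowerSeries.X =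
          unitCoordTwo hπ hq u (β.unitAct (γ ^ n))) :
    a' = (1 + PowerSeries.X) ^ n * a ∧ b' = (1 + PowerSeries.X) ^ n * b := by
  have h := unitCoordTwo_unitAct_pow_eq_pair hπ hq u hu γ β hab n
  rw [← hab'] at h
  exact (exists_tAct_twistLinear_two_and_unique hπ hq u hu γ w hγ).2 a' b' _ _ h.symm

end CoordFreeTwo

end Literature.NumberTheory.GaloisRepresentations
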